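import Mathlib
import HarnessLib
import Summits.HubbardSuperconductivity.HubbardSuperconductivity.Theorems.KLProgrammeKLRegimeEnginePairLadderTowerComposeV17F2

/-!
# Route `KLProgramme` — crux K3, ENGINE child gen 8 (stmt-HubbardSuperconductivity-20437 `KLRegimeEngineV17F2`), stub (c) `stub_engine_step_values`,
# (R47h) v2 class #5 «pair transfer» / RIDER (A): the FOURTH SIDE of the resummation square — `kltc_transfer_compose_fwd_on`

Cell gate-hubbard-kl, seat hubbard-kl-k3c1-p1 (g9), technique «composed-map remainder propagation».

At every scale four diagonal-weight resolvent relations form a square (all in the convention `F_v(C) := C·(1 + diag v·C)⁻¹`, `F_u ∘ F_v = F_{u+v}`):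

```
            plain step (E2)ₙ :  C₀ ──(w)──▶ C₁
  straddle (S)ₙ₋₁ : (−b′) │                 │ (−b) : straddle (S)ₙ      (the class-#5 export `PairTransferAt`, forward form:
                          ▼                 ▼                               `(1 − diag b·C₁)·M = 1`, `‖Y − C₁·M‖ ≤ R` on the ball)
             Wick step (W-a)ₙ :  X ──(w₁)──▶ Y
```

with the consistency `w = w₁ + b − b′` (the plain full rung = Wick rung + transfer increment).  `kltc_tower_compose_fwd` / `kltc_compose_fwd_on`
(p496062 / p526646) and the door `pairLadderStepAtV17F2_of_wickTower_fwd` (p528604) close the TOP-TO-BOTTOM direction: (S)ₙ₋₁ ∧ (W-a)ₙ ∧ (S)ₙ ⟹ (E2)ₙ.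
THIS file closes the remaining direction: **(S)ₙ₋₁ ∧ (W-a)ₙ ∧ (E2)ₙ ⟹ (S)ₙ** — the straddle at scale `n` with weight `b := b′ + w − w₁`, its defect
propagated through the chain `C₁ → C₀ → X → Y` (the plain step inverted EXACTLY at the start, `kltc_inverse_map`; then two weighted kernel
perturbations) — which is `kltc_tower_compose` (p494435) read with the arrays relabelled `(C₀, X, Y, C₁) ↦ (C₁, C₀, X, Y)` and the weights
`(μ′, w₁, μ) ↦ (−w, −b′, −w₁)`.

Consequence for the v2 composition ((R47h), RIDER (A) «(S)ₙ re-proved inside slice n»): modulo (S)ₙ₋₁ (history, class #5 at `n−1`) and the Wick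
step (W-a)ₙ (the KLTC scale-flow doors), the slot conjunct (E2-F2)ₙ and the export `PairTransferAt n` are ONE obligation: whichever of the two the
(c) lane proves from scratch, the other is a door away (`pairLadderStepAtV17F2_of_wickTower_fwd` one way, `pairTransferFwd_succ_*` below the other way).

* §1 `kltc_transfer_compose_fwd_on` — any finite carrier, any truncation set `B`, arrays vanishing off `B²`, REAL weights, errors on `B²`;
  smallness `(m + e)·Σ|w + b′| ≤ 1/3`, `((3/2)m + e₁)·Σ|w₁| ≤ 1/3` (`m ≥ sup|C₁|`, `e ≥ sup E`, `e₁ ≥ sup E₁`, `E₁ ≥ R′ + FT_{|w+b′|}(E)`).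
* §2 (model, bare ball, `C_j := klPairArrayF … j Qm`): `pairTransferFwd_succ_klPairArrayF` (explicit plain-step data `w, N₀, E` in the literal shape of the
  (E2-F2) clause — the form the (c) closer holds BEFORE wrapping its `∃`), and `pairTransferFwd_succ_of_pairLadderStepAtV17F2` (from the slot PROP
  `PairLadderStepAtV17F2 … n`, `1 ≤ n`, with the four-term form flattened through `E ≤ e` since the clause hides its weight: output re-exports the
  clause's two mass lines of `w` next to the new straddle with weight `b′ + w − w₁`).

Exact algebra over landed lemmas; nothing about the model's sizes is asserted.  0 kit.
-/

noncomputable section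

namespace Summit.HubbardSuperconductivity.HubbardSuperconductivity.Theorems.KLRegimeSplit

set_option linter.dupNamespace false -- summit = problem name (single-conjunct summit), D-0017

open Finset Matrix Literature.MathematicalPhysics.QuantumLattice Literature.Probability.LatticeModels
open Summit.HubbardSuperconductivity.HubbardSuperconductivity.Theorems.KLProgrammeLegKernels

/-! ## §1 The fourth side of the square on an arbitrary truncation set -/

section Compose

variable {S : Type*} [Fintype S] [DecidableEq S] [Nonempty S]

/-- **Transfer (straddle) propagation across one step — the fourth side of the resummation square.**  Arrays `C₀, C₁` (plain, scales `n−1`, `n`;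
`|C₁| ≤ m`), `X, Y` (Wick, scales `n−1`, `n`), all vanishing off `B²`; real weights `w` (plain step), `b′` (straddle at `n−1`), `w₁` (Wick step);
right inverses `N₀` of `1 + diag w·C₀`, `M′` of `1 − diag b′·C₀`, `N` of `1 + diag w₁·X`; error majorants on `B²`: `‖C₁ − C₀N₀‖ ≤ E ≤ e` (plain step),
`‖X − C₀M′‖ ≤ R′` (straddle), `‖Y − XN‖ ≤ E_a` (Wick step); an intermediate majorant `E₁ ≥ R′ + FT_{|w+b′|}(E)`, `E₁ ≤ e₁`; smallness
`(m + e)·Σ|w + b′| ≤ 1/3`, `((3/2)m + e₁)·Σ|w₁| ≤ 1/3`.  THEN `1 − diag(b′ + w − w₁)·C₁` has a two-sided inverse `M₀` and on `B²`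
`‖Y − C₁M₀‖(k,k′) ≤ E_a(k,k′) + E₁(k,k′) + (3/2)(3/2 m)·Σ_t E₁(k,t)|w₁ t| + (3/2)((3/2)m + e₁)·Σ_a |w₁ a| E₁(a,k′) + (9/4)((3/2)m + e₁)(3/2 m)·Σ_aΣ_t |w₁ a| E₁(a,t) |w₁ t|`
— the straddle (S)ₙ in forward form with the consistent weight (`w = w₁ + b − b′`). -/
theorem kltc_transfer_compose_fwd_on (B : Finset S) (C₀ C₁ X Y N₀ M' N : Matrix S S ℂ) (w b' w₁ : S → ℝ) (E R' Ea E₁ : S → S → ℝ)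
    {m e e₁ : ℝ} (hm : 0 ≤ m) (he : 0 ≤ e) (he₁ : 0 ≤ e₁) (hC₁ : ∀ s t, ‖C₁ s t‖ ≤ m)
    (hC₀0 : ∀ x y, ¬(x ∈ B ∧ y ∈ B) → C₀ x y = 0) (hC₁0 : ∀ x y, ¬(x ∈ B ∧ y ∈ B) → C₁ x y = 0)
    (hX0 : ∀ x y, ¬(x ∈ B ∧ y ∈ B) → X x y = 0) (hY0 : ∀ x y, ¬(x ∈ B ∧ y ∈ B) → Y x y = 0)
    (hE0 : ∀ x y, 0 ≤ E x y) (hR'0 : ∀ x y, 0 ≤ R' x y) (hEa0 : ∀ x y, 0 ≤ Ea x y)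
    (hN₀ : (1 + diagonal (fun p => (w p : ℂ)) * C₀) * N₀ = 1)
    (hE : ∀ k ∈ B, ∀ k' ∈ B, ‖C₁ k k' - (C₀ * N₀) k k'‖ ≤ E k k') (hEe : ∀ x y, E x y ≤ e)
    (hM' : (1 - diagonal (fun p => (b' p : ℂ)) * C₀) * M' = 1)
    (hR' : ∀ k ∈ B, ∀ k' ∈ B, ‖X k k' - (C₀ * M') k k'‖ ≤ R' k k')
    (hN : (1 + diagonal (fun p => (w₁ p : ℂ)) * X) * N = 1)
    (hEa : ∀ k ∈ B, ∀ k' ∈ B, ‖Y k k' - (X * N) k k'‖ ≤ Ea k k')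
    (hE₁ : ∀ x y, R' x y + (E x y + 3 / 2 * m * ∑ t, E x t * |w t + b' t| + 3 / 2 * (m + e) * ∑ a, |w a + b' a| * E a y +
        9 / 4 * (m + e) * m * ∑ a, ∑ t, |w a + b' a| * E a t * |w t + b' t|) ≤ E₁ x y)
    (hE₁e : ∀ x y, E₁ x y ≤ e₁)
    (hsm₁ : (m + e) * ∑ a, |w a + b' a| ≤ 1 / 3) (hsm₂ : (3 / 2 * m + e₁) * ∑ a, |w₁ a| ≤ 1 / 3) :
    ∃ M₀ : Matrix S S ℂ,
      (1 - diagonal (fun p => ((b' p + w p - w₁ p : ℝ) : ℂ)) * C₁) * M₀ = 1 ∧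
      M₀ * (1 - diagonal (fun p => ((b' p + w p - w₁ p : ℝ) : ℂ)) * C₁) = 1 ∧
      ∀ k ∈ B, ∀ k' ∈ B,
        ‖Y k k' - (C₁ * M₀) k k'‖ ≤
          Ea k k' + (E₁ k k' + 3 / 2 * (3 / 2 * m) * ∑ t, E₁ k t * |w₁ t| + 3 / 2 * (3 / 2 * m + e₁) * ∑ a, |w₁ a| * E₁ a k' +
            9 / 4 * (3 / 2 * m + e₁) * (3 / 2 * m) * ∑ a, ∑ t, |w₁ a| * E₁ a t * |w₁ t|) := by
  -- the three right-inverse relations in the `1 + D·A` normal form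
  have hM'alt : (1 + (-diagonal (fun p => (b' p : ℂ))) * C₀) * M' = 1 := by
    rw [neg_mul, ← sub_eq_add_neg]; exact hM'
  -- vanishing of the resummed arrays off `B²`
  have hC₀N₀0 : ∀ x y, ¬(x ∈ B ∧ y ∈ B) → (C₀ * N₀) x y = 0 := fun x y hxy =>
    kltc_mul_rightInv_apply_eq_zero C₀ _ N₀ B hN₀ hC₀0 hxy
  have hC₀M'0 : ∀ x y, ¬(x ∈ B ∧ y ∈ B) → (C₀ * M') x y = 0 := fun x y hxy =>
    kltc_mul_rightInv_apply_eq_zero C₀ _ M' B hM'alt hC₀0 hxy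
  have hXN0 : ∀ x y, ¬(x ∈ B ∧ y ∈ B) → (X * N) x y = 0 := fun x y hxy =>
    kltc_mul_rightInv_apply_eq_zero X _ N B hN hX0 hxy
  -- global error bounds
  have gE : ∀ x y, ‖C₁ x y - (C₀ * N₀) x y‖ ≤ E x y := by
    intro x y
    by_cases hxy : x ∈ B ∧ y ∈ B
    · exact hE x hxy.1 y hxy.2
    · rw [hC₁0 x y hxy, hC₀N₀0 x y hxy, sub_zero, norm_zero]; exact hE0 x y
  have gR' : ∀ x y, ‖X x y - (C₀ * M') x y‖ ≤ R' x y := by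
    intro x y
    by_cases hxy : x ∈ B ∧ y ∈ B
    · exact hR' x hxy.1 y hxy.2
    · rw [hX0 x y hxy, hC₀M'0 x y hxy, sub_zero, norm_zero]; exact hR'0 x y
  have gEa : ∀ x y, ‖Y x y - (X * N) x y‖ ≤ Ea x y := by
    intro x y
    by_cases hxy : x ∈ B ∧ y ∈ B
    · exact hEa x hxy.1 y hxy.2
    · rw [hY0 x y hxy, hXN0 x y hxy, sub_zero, norm_zero]; exact hEa0 x y
  -- the relabelled weights `μ′ := −w`, `w₁ := −b′`, `μ := −w₁` and their majorant profiles
  have hρ : ∀ a, ‖(-(b' a : ℂ)) + (-(w a : ℂ))‖ ≤ |w a + b' a| := by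
    intro a
    rw [← neg_add, norm_neg, ← Complex.ofReal_add, Complex.norm_real, Real.norm_eq_abs, add_comm]
  have hσ : ∀ a, ‖(-(w₁ a : ℂ))‖ ≤ |w₁ a| := fun a => by rw [norm_neg, Complex.norm_real, Real.norm_eq_abs]
  have hdw : diagonal (fun a => -(w a : ℂ)) = -diagonal (fun p => (w p : ℂ)) := (diagonal_neg _).symm
  have hdb' : diagonal (fun a => -(b' a : ℂ)) = -diagonal (fun p => (b' p : ℂ)) := (diagonal_neg _).symm
  have hdw₁ : diagonal (fun a => -(w₁ a : ℂ)) = -diagonal (fun p => (w₁ p : ℂ)) := (diagonal_neg _).symm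
  have hN'tc : (1 - diagonal (fun a => -(w a : ℂ)) * C₀) * N₀ = 1 := by
    rw [hdw, neg_mul, sub_neg_eq_add]; exact hN₀
  have hNtc : (1 + diagonal (fun a => -(b' a : ℂ)) * C₀) * M' = 1 := by
    rw [hdb']; exact hM'alt
  have hN''tc : (1 - diagonal (fun a => -(w₁ a : ℂ)) * X) * N = 1 := by
    rw [hdw₁, neg_mul, sub_neg_eq_add]; exact hN
  -- the three-relation tower, relabelled
  obtain ⟨M₀, h1, h2, hbd⟩ := kltc_tower_compose C₁ Y C₀ X N₀ M' N (fun a => -(w a : ℂ)) (fun a => -(b' a : ℂ))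
    (fun a => -(w₁ a : ℂ)) (fun a => |w a + b' a|) (fun a => |w₁ a|) E R' Ea E₁ hm he he₁ hC₁ hρ hσ hN'tc gE hEe hNtc gR' hN''tc gEa
    hE₁ hE₁e hsm₁ hsm₂
  have hfun : (fun a => (-(b' a : ℂ)) + (-(w a : ℂ)) - (-(w₁ a : ℂ))) = fun a => -(((b' a + w a - w₁ a : ℝ)) : ℂ) := by
    funext a; push_cast; ring
  have hdiag : diagonal (fun a => (-(b' a : ℂ)) + (-(w a : ℂ)) - (-(w₁ a : ℂ))) =
      -diagonal (fun p => ((b' p + w p - w₁ p : ℝ) : ℂ)) := by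
    rw [hfun]; exact (diagonal_neg _).symm
  rw [hdiag, neg_mul, ← sub_eq_add_neg] at h1 h2
  exact ⟨M₀, h1, h2, fun k _ k' _ => hbd k k'⟩

end Compose

/-! ## §2 Model: the straddle at scale `n` from the (E2-F2) step data, on the bare ball -/

section Model

variable (L M : ℕ) [NeZero L] [NeZero M]

/-- **(S)ₙ from (S)ₙ₋₁, the Wick step and EXPLICIT (E2-F2) step data.**  Instance of `kltc_transfer_compose_fwd_on` with `B := klBall L μ 0`,
`C₀ := klPairArrayF … (n−1) Qm`, `C₁ := klPairArrayF … n Qm`; the plain-step error hypothesis is stated in the literal shape of the (E2-F2) clause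
(`klPairAmplitude` at the flow frame `K_n` against the resummed scale-`(n−1)` array, on the bare ball), with an abstract entrywise majorant `E`
(`0 ≤ E ≤ e`) in place of the closed-form budget — the caller (the (c) closer, who holds `w, N₀` before wrapping the clause's `∃`) feeds `E :=` the
budget line or anything above it.  Output: the forward straddle at scale `n` with weight `b′ + w − w₁`. -/
theorem pairTransferFwd_succ_klPairArrayF {β U μ : ℝ} {n : ℕ} (Qm : TorusSite 2 L)
    (X Y N₀ M' N : Matrix (TorusSite 2 L) (TorusSite 2 L) ℂ) (w b' w₁ : TorusSite 2 L → ℝ)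
    (E R' Ea E₁ : TorusSite 2 L → TorusSite 2 L → ℝ) {m e e₁ : ℝ} (hm : 0 ≤ m) (he : 0 ≤ e) (he₁ : 0 ≤ e₁)
    (hC₁ : ∀ s t, ‖klPairArrayF L M β U μ n Qm s t‖ ≤ m)
    (hX0 : ∀ x y, ¬(x ∈ klBall L μ 0 ∧ y ∈ klBall L μ 0) → X x y = 0)
    (hY0 : ∀ x y, ¬(x ∈ klBall L μ 0 ∧ y ∈ klBall L μ 0) → Y x y = 0)
    (hE0 : ∀ x y, 0 ≤ E x y) (hR'0 : ∀ x y, 0 ≤ R' x y) (hEa0 : ∀ x y, 0 ≤ Ea x y)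
    (hN₀ : (1 + diagonal (fun p => (w p : ℂ)) * klPairArrayF L M β U μ (n - 1) Qm) * N₀ = 1)
    (hE : ∀ k ∈ klBall L μ 0, ∀ k' ∈ klBall L μ 0,
      ‖klPairAmplitude L M β U μ (klFlowFrameU L M β U μ n) n Qm k k' - (klPairArrayF L M β U μ (n - 1) Qm * N₀) k k'‖ ≤ E k k')
    (hEe : ∀ x y, E x y ≤ e)
    (hM' : (1 - diagonal (fun p => (b' p : ℂ)) * klPairArrayF L M β U μ (n - 1) Qm) * M' = 1)
    (hR' : ∀ k ∈ klBall L μ 0, ∀ k' ∈ klBall L μ 0, ‖X k k' - (klPairArrayF L M β U μ (n - 1) Qm * M') k k'‖ ≤ R' k k')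
    (hN : (1 + diagonal (fun p => (w₁ p : ℂ)) * X) * N = 1)
    (hEa : ∀ k ∈ klBall L μ 0, ∀ k' ∈ klBall L μ 0, ‖Y k k' - (X * N) k k'‖ ≤ Ea k k')
    (hE₁ : ∀ x y, R' x y + (E x y + 3 / 2 * m * ∑ t, E x t * |w t + b' t| + 3 / 2 * (m + e) * ∑ a, |w a + b' a| * E a y +
        9 / 4 * (m + e) * m * ∑ a, ∑ t, |w a + b' a| * E a t * |w t + b' t|) ≤ E₁ x y)
    (hE₁e : ∀ x y, E₁ x y ≤ e₁)
    (hsm₁ : (m + e) * ∑ a, |w a + b' a| ≤ 1 / 3) (hsm₂ : (3 / 2 * m + e₁) * ∑ a, |w₁ a| ≤ 1 / 3) :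
    ∃ M₀ : Matrix (TorusSite 2 L) (TorusSite 2 L) ℂ,
      (1 - diagonal (fun p => ((b' p + w p - w₁ p : ℝ) : ℂ)) * klPairArrayF L M β U μ n Qm) * M₀ = 1 ∧
      M₀ * (1 - diagonal (fun p => ((b' p + w p - w₁ p : ℝ) : ℂ)) * klPairArrayF L M β U μ n Qm) = 1 ∧
      ∀ k ∈ klBall L μ 0, ∀ k' ∈ klBall L μ 0,
        ‖Y k k' - (klPairArrayF L M β U μ n Qm * M₀) k k'‖ ≤
          Ea k k' + (E₁ k k' + 3 / 2 * (3 / 2 * m) * ∑ t, E₁ k t * |w₁ t| + 3 / 2 * (3 / 2 * m + e₁) * ∑ a, |w₁ a| * E₁ a k' +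
            9 / 4 * (3 / 2 * m + e₁) * (3 / 2 * m) * ∑ a, ∑ t, |w₁ a| * E₁ a t * |w₁ t|) := by
  have hE' : ∀ k ∈ klBall L μ 0, ∀ k' ∈ klBall L μ 0,
      ‖klPairArrayF L M β U μ n Qm k k' - (klPairArrayF L M β U μ (n - 1) Qm * N₀) k k'‖ ≤ E k k' := by
    intro k hk k' hk'
    rw [klPairArrayF_apply_of_mem L M β U μ n Qm hk hk']
    exact hE k hk k' hk'
  exact kltc_transfer_compose_fwd_on (klBall L μ 0) (klPairArrayF L M β U μ (n - 1) Qm) (klPairArrayF L M β U μ n Qm) X Y N₀ M' N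
    w b' w₁ E R' Ea E₁ hm he he₁ hC₁ (klPairArrayF_eq_zero_off L M β U μ (n - 1) Qm) (klPairArrayF_eq_zero_off L M β U μ n Qm) hX0 hY0
    hE0 hR'0 hEa0 hN₀ hE' hEe hM' hR' hN hEa hE₁ hE₁e hsm₁ hsm₂

/-- **(S)ₙ from (S)ₙ₋₁, the Wick step and the slot PROP `PairLadderStepAtV17F2 … n` (`1 ≤ n`).**  The clause hides its weight `w` behind `∃`, so the
four-term form is flattened through `E ≤ e` and `Σ|w + b′| ≤ G.bhi + Σ|b′|` (`=: Z`): with `E ≥` the clause's budget line on the bare ball (`0 ≤ E ≤ e`),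
`R′ ≤ r′`, and `e₁ ≥ r′ + e + (3/2)m·eZ + (3/2)(m+e)·eZ + (9/4)(m+e)m·eZ²`, smallness `(m + e)·Z ≤ 1/3`, `((3/2)m + e₁)·Σ|w₁| ≤ 1/3` ⟹ there is a real
weight `w` carrying the clause's two mass lines and a two-sided inverse `M₀` of `1 − diag(b′ + w − w₁)·klPairArrayF n Qm` with
`‖Y − klPairArrayF n Qm·M₀‖ ≤ E_a + FT_{|w₁|}(E₁)` on the bare ball, `E₁(k,k′) := R′(k,k′) + E(k,k′) + (3/2)m·eZ + (3/2)(m+e)·eZ + (9/4)(m+e)m·eZ²`.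
I.e. modulo (S)ₙ₋₁ and (W-a)ₙ the slot conjunct (E2-F2)ₙ IMPLIES the class-#5 straddle at `n`. -/
theorem pairTransferFwd_succ_of_pairLadderStepAtV17F2 {G : GeoConsts} {P : SplitConsts} {Q : EngConsts} {β U μ : ℝ} {n : ℕ} (hn : 1 ≤ n)
    (hE2 : PairLadderStepAtV17F2 L M G P Q β U μ n) {Qm : TorusSite 2 L} (hQm : IsPairClassAt L Qm n)
    (X Y M' N : Matrix (TorusSite 2 L) (TorusSite 2 L) ℂ) (b' w₁ : TorusSite 2 L → ℝ)
    (E R' Ea : TorusSite 2 L → TorusSite 2 L → ℝ) {m e r' e₁ : ℝ} (hm : 0 ≤ m) (he : 0 ≤ e) (hr' : 0 ≤ r')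
    (hC₁ : ∀ s t, ‖klPairArrayF L M β U μ n Qm s t‖ ≤ m)
    (hX0 : ∀ x y, ¬(x ∈ klBall L μ 0 ∧ y ∈ klBall L μ 0) → X x y = 0)
    (hY0 : ∀ x y, ¬(x ∈ klBall L μ 0 ∧ y ∈ klBall L μ 0) → Y x y = 0)
    (hE0 : ∀ x y, 0 ≤ E x y) (hR'0 : ∀ x y, 0 ≤ R' x y) (hEa0 : ∀ x y, 0 ≤ Ea x y)
    (hEbud : ∀ k ∈ klBall L μ 0, ∀ k' ∈ klBall L μ 0,
      drivePBar G P U (n - 1) + eremBar G P Q U β L (n - 1) + thermalBar G P U β n +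
          legDressBarQ2 G P Q U n (legSliceCountT L β μ (klFlowFrameU L M β U μ n) n ![k', Qm - k', Qm - k, k]) +
          (P.Klam * U) ^ 2 * (G.phGain n (klTorusNorm L (k - k')) + G.phGain n (klTorusNorm L (k + k' - Qm))) +
          frameShiftBar P Q U n ≤ E k k')
    (hEe : ∀ x y, E x y ≤ e)
    (hM' : (1 - diagonal (fun p => (b' p : ℂ)) * klPairArrayF L M β U μ (n - 1) Qm) * M' = 1)
    (hR' : ∀ k ∈ klBall L μ 0, ∀ k' ∈ klBall L μ 0, ‖X k k' - (klPairArrayF L M β U μ (n - 1) Qm * M') k k'‖ ≤ R' k k')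
    (hR'e : ∀ x y, R' x y ≤ r')
    (hN : (1 + diagonal (fun p => (w₁ p : ℂ)) * X) * N = 1)
    (hEa : ∀ k ∈ klBall L μ 0, ∀ k' ∈ klBall L μ 0, ‖Y k k' - (X * N) k k'‖ ≤ Ea k k')
    (he₁ : r' + e + (3 / 2 * m * (e * (G.bhi + ∑ a, |b' a|)) + 3 / 2 * (m + e) * (e * (G.bhi + ∑ a, |b' a|)) +
        9 / 4 * (m + e) * m * (e * (G.bhi + ∑ a, |b' a|) ^ 2)) ≤ e₁)
    (hsm₁ : (m + e) * (G.bhi + ∑ a, |b' a|) ≤ 1 / 3) (hsm₂ : (3 / 2 * m + e₁) * ∑ a, |w₁ a| ≤ 1 / 3) :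
    ∃ w : TorusSite 2 L → ℝ, (∑ p, |w p| ≤ G.bhi) ∧ (∑ p, (|w p| - w p) ≤ 2 * klEdge G n (klTorusNorm L Qm)) ∧
      ∃ M₀ : Matrix (TorusSite 2 L) (TorusSite 2 L) ℂ,
        (1 - diagonal (fun p => ((b' p + w p - w₁ p : ℝ) : ℂ)) * klPairArrayF L M β U μ n Qm) * M₀ = 1 ∧
        M₀ * (1 - diagonal (fun p => ((b' p + w p - w₁ p : ℝ) : ℂ)) * klPairArrayF L M β U μ n Qm) = 1 ∧
        ∀ k ∈ klBall L μ 0, ∀ k' ∈ klBall L μ 0,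
          ‖Y k k' - (klPairArrayF L M β U μ n Qm * M₀) k k'‖ ≤
            Ea k k' +
              ((R' k k' + E k k' + (3 / 2 * m * (e * (G.bhi + ∑ a, |b' a|)) + 3 / 2 * (m + e) * (e * (G.bhi + ∑ a, |b' a|)) +
                  9 / 4 * (m + e) * m * (e * (G.bhi + ∑ a, |b' a|) ^ 2))) +
                3 / 2 * (3 / 2 * m) * ∑ t, (R' k t + E k t + (3 / 2 * m * (e * (G.bhi + ∑ a, |b' a|)) +
                    3 / 2 * (m + e) * (e * (G.bhi + ∑ a, |b' a|)) + 9 / 4 * (m + e) * m * (e * (G.bhi + ∑ a, |b' a|) ^ 2))) * |w₁ t| +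
                3 / 2 * (3 / 2 * m + e₁) * ∑ a, |w₁ a| * (R' a k' + E a k' + (3 / 2 * m * (e * (G.bhi + ∑ a, |b' a|)) +
                    3 / 2 * (m + e) * (e * (G.bhi + ∑ a, |b' a|)) + 9 / 4 * (m + e) * m * (e * (G.bhi + ∑ a, |b' a|) ^ 2))) +
                9 / 4 * (3 / 2 * m + e₁) * (3 / 2 * m) * ∑ a, ∑ t, |w₁ a| * (R' a t + E a t + (3 / 2 * m * (e * (G.bhi + ∑ a, |b' a|)) +
                    3 / 2 * (m + e) * (e * (G.bhi + ∑ a, |b' a|)) + 9 / 4 * (m + e) * m * (e * (G.bhi + ∑ a, |b' a|) ^ 2))) * |w₁ t|) := by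
  obtain ⟨w, hmass, hneg, N₀, hN₀, hbud⟩ := hE2.2 hn Qm hQm
  -- abbreviations
  set Z : ℝ := G.bhi + ∑ a, |b' a| with hZ_def
  set c : ℝ := 3 / 2 * m * (e * Z) + 3 / 2 * (m + e) * (e * Z) + 9 / 4 * (m + e) * m * (e * Z ^ 2) with hc_def
  set E₁ : TorusSite 2 L → TorusSite 2 L → ℝ := fun x y => R' x y + E x y + c with hE₁_def
  -- the plain-step error against the abstract majorant
  have hE : ∀ k ∈ klBall L μ 0, ∀ k' ∈ klBall L μ 0,
      ‖klPairAmplitude L M β U μ (klFlowFrameU L M β U μ n) n Qm k k' - (klPairArrayF L M β U μ (n - 1) Qm * N₀) k k'‖ ≤ E k k' :=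
    fun k hk k' hk' => (hbud k hk k' hk').trans (hEbud k hk k' hk')
  -- the mass of `w + b′`
  have hρZ : ∑ a, |w a + b' a| ≤ Z := by
    calc ∑ a, |w a + b' a| ≤ ∑ a, (|w a| + |b' a|) := sum_le_sum fun a _ => abs_add_le _ _
      _ = ∑ a, |w a| + ∑ a, |b' a| := sum_add_distrib
      _ ≤ G.bhi + ∑ a, |b' a| := by linarith [hmass]
  have hρ0 : ∀ a, 0 ≤ |w a + b' a| := fun a => abs_nonneg _
  have hZ0 : 0 ≤ Z := (sum_nonneg fun a _ => hρ0 a).trans hρZ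
  have hme : 0 ≤ m + e := add_nonneg hm he
  have heZ : 0 ≤ e * Z := mul_nonneg he hZ0
  have hc0 : 0 ≤ c := by rw [hc_def]; positivity
  -- the flattened four-term form
  have hFT : ∀ x y, R' x y + (E x y + 3 / 2 * m * ∑ t, E x t * |w t + b' t| + 3 / 2 * (m + e) * ∑ a, |w a + b' a| * E a y +
      9 / 4 * (m + e) * m * ∑ a, ∑ t, |w a + b' a| * E a t * |w t + b' t|) ≤ E₁ x y := by
    intro x y
    have h1 : ∑ t, E x t * |w t + b' t| ≤ e * Z := by
      calc ∑ t, E x t * |w t + b' t| ≤ ∑ t, e * |w t + b' t| := sum_le_sum fun t _ => mul_le_mul_of_nonneg_right (hEe x t) (hρ0 t)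
        _ = e * ∑ t, |w t + b' t| := by rw [mul_sum]
        _ ≤ e * Z := mul_le_mul_of_nonneg_left hρZ he
    have h2 : ∑ a, |w a + b' a| * E a y ≤ e * Z := by
      calc ∑ a, |w a + b' a| * E a y ≤ ∑ a, |w a + b' a| * e := sum_le_sum fun a _ => mul_le_mul_of_nonneg_left (hEe a y) (hρ0 a)
        _ = e * ∑ a, |w a + b' a| := by rw [← sum_mul, mul_comm]
        _ ≤ e * Z := mul_le_mul_of_nonneg_left hρZ he
    have h3 : ∑ a, ∑ t, |w a + b' a| * E a t * |w t + b' t| ≤ e * Z ^ 2 := by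
      calc ∑ a, ∑ t, |w a + b' a| * E a t * |w t + b' t| ≤ ∑ a, ∑ t, |w a + b' a| * e * |w t + b' t| :=
            sum_le_sum fun a _ => sum_le_sum fun t _ =>
              mul_le_mul_of_nonneg_right (mul_le_mul_of_nonneg_left (hEe a t) (hρ0 a)) (hρ0 t)
        _ = e * ((∑ a, |w a + b' a|) * ∑ t, |w t + b' t|) := by
            rw [sum_mul_sum]; rw [mul_sum]; refine sum_congr rfl fun a _ => ?_; rw [mul_sum]
            exact sum_congr rfl fun t _ => by ring
        _ ≤ e * (Z * Z) := mul_le_mul_of_nonneg_left (mul_le_mul hρZ hρZ (sum_nonneg fun t _ => hρ0 t) hZ0) he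
        _ = e * Z ^ 2 := by ring
    have e1 : 3 / 2 * m * ∑ t, E x t * |w t + b' t| ≤ 3 / 2 * m * (e * Z) := mul_le_mul_of_nonneg_left h1 (by positivity)
    have e2 : 3 / 2 * (m + e) * ∑ a, |w a + b' a| * E a y ≤ 3 / 2 * (m + e) * (e * Z) := mul_le_mul_of_nonneg_left h2 (by positivity)
    have e3 : 9 / 4 * (m + e) * m * ∑ a, ∑ t, |w a + b' a| * E a t * |w t + b' t| ≤ 9 / 4 * (m + e) * m * (e * Z ^ 2) :=
      mul_le_mul_of_nonneg_left h3 (by positivity)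
    simp only [hE₁_def, hc_def]
    linarith
  have he₁' : 0 ≤ e₁ := by
    have : 0 ≤ r' + e + c := by positivity
    exact this.trans (by rw [hc_def]; exact he₁)
  have hE₁e : ∀ x y, E₁ x y ≤ e₁ := by
    intro x y
    simp only [hE₁_def]
    have := hR'e x y; have := hEe x y
    calc R' x y + E x y + c ≤ r' + e + c := by linarith
      _ ≤ e₁ := by rw [hc_def]; exact he₁
  have hsm₁' : (m + e) * ∑ a, |w a + b' a| ≤ 1 / 3 := (mul_le_mul_of_nonneg_left hρZ hme).trans hsm₁
  obtain ⟨M₀, h1, h2, hbd⟩ := pairTransferFwd_succ_klPairArrayF L M Qm X Y N₀ M' N w b' w₁ E R' Ea E₁ hm he he₁' hC₁ hX0 hY0 hE0 hR'0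
    hEa0 hN₀ hE hEe hM' hR' hN hEa hFT hE₁e hsm₁' hsm₂
  refine ⟨w, hmass, hneg, M₀, h1, h2, fun k hk k' hk' => ?_⟩
  have h := hbd k hk k' hk'
  simp only [hE₁_def, hc_def, hZ_def] at h
  exact h

end Model

end Summit.HubbardSuperconductivity.HubbardSuperconductivity.Theorems.KLRegimeSplit

end
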